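import Literature.IUT.HodgeTheaters.FrobenioidBridgeModels
import Literature.IUT.HodgeTheaters.BaseThetaDatumModel

/-!
# [IUTchI] Example 5.4 (vi): the independence claim `Ex54vi` is satisfiable and independent of the §5 stub `S5Local`

Mochizuki, *Inter-universal Teichmüller theory I*, §5, Example 5.4 (vi) pp. 149–150, kurims manuscript (May
2020) [claim: Mochizuki2012, status: disputed]: the restriction functors induced by a poly-morphism
`†ℱ_⟨J⟩ → †ℱ^⊚` are "independent of the choice of the poly-morphism `†ℱ_⟨J⟩ → †ℱ^⊚`" — typed by abc-iut-L5-t3 as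
the named statement `BaseThetaDatum.S5Local.Ex54vi S` over the Frobenioid-level hypothesis structure `S5Local 𝔡`
(`FrobenioidBridgeModels.lean`), i.e. `S.restrictionOf d X δ = S.restrictionOf d X δ'` for all `δ, δ'`, where the
restriction data `S.RestrictionDatum` / `S.restrictionOf` are FIELDS of the stub (TODO-merge with abc-iut-L5-t1's
global Frobenioids of Example 5.1). PROOF-ONLY companion (theorems, no definitions) by the wave-4 discharge seat
abc-iut-w4-d073 (home layer L5); node id IUTchI:Ex5.4(vi) (plan/FACT-LIST.md draft row F-2000).

This file makes the status of `Ex54vi` KERNEL-CHECKED at the interface level, over abc-iut-L5-t3's combinatorial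
base model `BaseThetaDatum.trivialModel` (`BaseThetaDatumModel.lean`, `l = 5`):

* `S5Local.exists_ex54vi` — a stub (the `ℱ`-level ambient categories EQUAL to the base ones, identity base
  functors, trivial `⇢` / valuation / restriction data: abc-iut-L5-t3's consistency inhabitant, re-built inline)
  over which `Ex54vi` HOLDS — the claim is satisfiable together with every stub clause;
* `S5Local.exists_not_ex54vi` — the same stub with the restriction datum taken to be the label class ITSELF
  (`RestrictionDatum := LabCusp(†𝒟^⊚)`, `restrictionOf d X δ := δ`; every stub clause still holds) over which
  `Ex54vi` FAILS, because `LabCusp(𝒟^⊚) = 𝔽_5^⋇` has two elements.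

Hence Example 5.4 (vi) AS TYPED is genuine input about the restriction functors of the global Frobenioids
(`†ℱ^⊛_mod` "defined in terms of terminal objects of `†𝒟^⊛`", p. 150) that the stub `S5Local` does not carry: it
can neither be discharged nor refuted over the stub as it stands (construct-after-merge, plan/L5/DISCHARGE-L5.md
§E), and a consumer inside the [IUTchIII] Cor. 3.12 cone must take it BY NAME until the merge with Example 5.1's
real restriction functors (plan/GAP-LEDGER discipline, D-0067). Record only; nothing here takes a side on any
disputed step; typed ≠ proved.
-/

namespace Literature.IUT.HodgeTheaters

open CategoryTheory

namespace BaseThetaDatum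

open TrivialModel

namespace S5Local

/-- **Ex 5.4 (vi) is satisfiable over the stub**: with trivial restriction data (abc-iut-L5-t3's consistency
inhabitant of `S5Local trivialModel`) the independence claim `Ex54vi` holds.
[claim: Mochizuki2012, status: disputed] -/
theorem exists_ex54vi : ∃ S : S5Local trivialModel, Ex54vi S := by
  classical
  let S : S5Local trivialModel :=
    { FAmb := fun _ => LocAmb
      F := fun _ => SingleObj.star _
      nonempty_isoF := fun _ _ _ => ⟨Iso.refl _⟩
      base := fun _ => 𝟭 _
      FAmbG := GlobAmb
      FG := SingleObj.star _
      nonempty_isoFG := fun _ _ => ⟨Iso.refl _⟩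
      baseG := fun Y => Y
      baseGIso := fun b => b
      baseGIso_refl := fun _ => rfl
      baseGIso_trans := fun _ _ => rfl
      FAmbGlob := GlobAmb
      FGlob := SingleObj.star _
      nonempty_isoFGlob := fun _ _ => ⟨Iso.refl _⟩
      DashArrow := fun _ _ => PUnit
      dashModel := PUnit.unit
      restrictAt := fun _ _ _ => SingleObj.star _
      ThetaHT := GlobAmb
      HT := SingleObj.star _
      nonempty_isoHT := fun _ _ => ⟨Iso.refl _⟩
      assocStrip := fun _ _ => SingleObj.star _
      assocStripIso := fun _ _ => Iso.refl _
      valOfNF := fun _ => ()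
      valOfNF_postNF := fun _ _ => rfl
      valOfNF_preNF := fun _ _ => rfl
      valOfNF_phiNF := fun _ => rfl
      RestrictionDatum := fun _ _ => PUnit
      restrictionOf := fun _ _ _ => PUnit.unit }
  exact ⟨S, fun _ _ _ _ _ _ => rfl⟩

/-- **Ex 5.4 (vi) is independent of the stub**: with the restriction datum of a poly-morphism
`†ℱ_⟨J⟩ → †ℱ^⊚|_δ` taken to be its label class `δ ∈ LabCusp(†𝒟^⊚) = 𝔽_5^⋇` (all other data as in the
consistency inhabitant) the independence claim `Ex54vi` FAILS: the two label classes of `𝔽_5^⋇` give different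
restriction data. [claim: Mochizuki2012, status: disputed] -/
theorem exists_not_ex54vi : ∃ S : S5Local trivialModel, ¬ Ex54vi S := by
  classical
  let S : S5Local trivialModel :=
    { FAmb := fun _ => LocAmb
      F := fun _ => SingleObj.star _
      nonempty_isoF := fun _ _ _ => ⟨Iso.refl _⟩
      base := fun _ => 𝟭 _
      FAmbG := GlobAmb
      FG := SingleObj.star _
      nonempty_isoFG := fun _ _ => ⟨Iso.refl _⟩
      baseG := fun Y => Y
      baseGIso := fun b => b
      baseGIso_refl := fun _ => rfl
      baseGIso_trans := fun _ _ => rfl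
      FAmbGlob := GlobAmb
      FGlob := SingleObj.star _
      nonempty_isoFGlob := fun _ _ => ⟨Iso.refl _⟩
      DashArrow := fun _ _ => PUnit
      dashModel := PUnit.unit
      restrictAt := fun _ _ _ => SingleObj.star _
      ThetaHT := GlobAmb
      HT := SingleObj.star _
      nonempty_isoHT := fun _ _ => ⟨Iso.refl _⟩
      assocStrip := fun _ _ => SingleObj.star _
      assocStripIso := fun _ _ => Iso.refl _
      valOfNF := fun _ => ()
      valOfNF_postNF := fun _ _ => rfl
      valOfNF_preNF := fun _ _ => rfl
      valOfNF_phiNF := fun _ => rfl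
      RestrictionDatum := fun _ _ => FlStar 5
      restrictionOf := fun _ _ δ => δ }
  refine ⟨S, fun h => ?_⟩
  -- `LabCusp(𝒟^⊚) = 𝔽_5^⋇` has two elements
  haveI : Fact (Nat.Prime 5) := ⟨by decide⟩
  have hcard : Nat.card (FlStar 5) = 2 := by
    rw [card_flStar 5 (by decide)]
    rfl
  have hnt : Nontrivial (FlStar 5) := by
    rw [← Finite.one_lt_card_iff_nontrivial, hcard]
    exact one_lt_two
  obtain ⟨δ, δ', hne⟩ := hnt
  exact hne (h S.FG S.FGlob S.dashModel S.F δ δ')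

end S5Local

end BaseThetaDatum

end Literature.IUT.HodgeTheaters
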